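import Literature.NumberTheory.DiophantineGeometry.GenEllFullGalois
import Literature.NumberTheory.GaloisRepresentations.AbsGaloisGroup
import HarnessLib

/-!
# [GenEll] Thm. 3.8, proof, step 1: the Galois image of `E_L` contains that of `E_{L′} = E_L ×_L L′`

S. Mochizuki, *Arithmetic elliptic curves in general position*, Math. J. Okayama Univ. 52 (2010)
[cite: MochizukiGenEll2010], proof of Theorem 3.8, p. 20, read on the page:

> First, let us observe that for an `E_L` as in the statement of Theorem 3.8, there exists a
> Galois extension `L′` of `L` of degree that divides `d₀ = (3² − 1)(3² − 3)(5² − 1)(5² − 5) = 23040`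
> […], so as to render the 3- and 5-torsion points of `E_L` rational over `L′` […], we may assume
> that `E_{L′} = E_L ×_L L′` has semi-stable reduction at all of the finite primes of `L`.

"We may assume" means: the conclusion "the image of Galois … contains `SL₂`" for `E_{L′}` (over the
smaller group `Gal(Q̄/L′) ⊆ Gal(Q̄/L)`) implies it for `E_L`.  In the tree's rendering the geometric
torsion of `E_{L′}` lives over `AlgebraicClosure L′` and that of `E_L` over `AlgebraicClosure L`;
this file supplies the comparison.

Topic `NumberTheory/DiophantineGeometry`.  Theorem-only file (no definition, no named fact), for a
presented elliptic curve `P = (E/L)` (`GenEll.EllPoint`) and its base change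
`P′ = ⟨L′, E ×_L L′⟩` to a finite extension `L′/L`:

* `GenEll.EllPoint.imageModLContainsSL2_of_baseChange` — for every `n ≥ 1`,
  `ImageModLContainsSL2 P′ n → ImageModLContainsSL2 P n` (`P′.W = P.W.map (algebraMap L L′)`, which
  is `P.W.baseChange L′` by `rfl`; the `map` form lets Mathlib's `IsElliptic` instance fire): along an `L`-isomorphism
  `ι : \overline{L′} ≃ \overline{L}` of algebraic closures (`IsAlgClosure.equivOfAlgebraic`) the
  geometric points correspond (`WeierstrassCurve.Affine.Point.map ι`), `Γ_{L′}`-equivariantly for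
  `τ ↦ ι ∘ τ ∘ ι⁻¹ : Γ_{L′} → Γ_L`; a determinant-one endomorphism of `E[n]` over `\overline{L}` is
  conjugate to one over `\overline{L′}`, realised there by some `τ`, hence realised by `ι τ ι⁻¹`.

## References

* S. Mochizuki, op. cit., proof of Thm. 3.8, p. 20. [MochizukiGenEll2010]
* J. H. Silverman, *The Arithmetic of Elliptic Curves*, III.§7 (the Galois representation on
  `E[m]` and base field extension). [SilvermanAEC2009]
-/

noncomputable section

open WeierstrassCurve Field

namespace Literature.NumberTheory.DiophantineGeometry.GenEll

namespace EllPoint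

open Literature.NumberTheory.EllipticCurves Literature.NumberTheory.GaloisRepresentations

universe u

variable (P : EllPoint) (L' : Type) [Field L'] [NumberField L'] [Algebra P.F L']

/-- **The image of `Gal(\overline{L}/L)` in `Aut(E[n])` contains `SL₂` as soon as the image of
`Gal(\overline{L′}/L′)` in `Aut(E_{L′}[n])` does**, for a finite extension `L′/L` ("we may assume
that `E_{L′} = E_L ×_L L′` …", proof of [GenEll] Thm. 3.8).
[cite: MochizukiGenEll2010, Thm 3.8 proof p.20] -/
theorem imageModLContainsSL2_of_baseChange (n : ℕ) [NeZero n]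
    (h : ({ F := L', W := P.W.map (algebraMap P.F L') } : EllPoint).ImageModLContainsSL2 n) :
    P.ImageModLContainsSL2 n := by
  classical
  set P' : EllPoint := { F := L', W := P.W.map (algebraMap P.F L') } with hP'
  -- the two algebraic closures
  haveI : Module.Finite P.F L' := Module.Finite.of_restrictScalars_finite ℚ P.F L'
  haveI : Algebra.IsAlgebraic P.F L' := Algebra.IsAlgebraic.of_finite P.F L'
  set ι : AlgebraicClosure L' ≃ₐ[P.F] AlgebraicClosure P.F :=
    IsAlgClosure.equivOfAlgebraic P.F L' (AlgebraicClosure L') (AlgebraicClosure P.F) with hι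
  -- transport of geometric points along `ι`
  set Φ : geomPoints (P.W.map (algebraMap P.F L')) →+ geomPoints P.W :=
    Affine.Point.map (W' := P.W) (ι : AlgebraicClosure L' →ₐ[P.F] AlgebraicClosure P.F) with hΦ
  set Ψ : geomPoints P.W →+ geomPoints (P.W.map (algebraMap P.F L')) :=
    Affine.Point.map (W' := P.W) (ι.symm : AlgebraicClosure P.F →ₐ[P.F] AlgebraicClosure L') with hΨ
  have hΨΦ : ∀ Q, Ψ (Φ Q) = Q := by
    intro Q
    have hcomp : (ι.symm : AlgebraicClosure P.F →ₐ[P.F] AlgebraicClosure L').comp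
        (ι : AlgebraicClosure L' →ₐ[P.F] AlgebraicClosure P.F) = AlgHom.id P.F _ := by
      ext x; exact ι.symm_apply_apply x
    show Affine.Point.map (W' := P.W) (ι.symm : AlgebraicClosure P.F →ₐ[P.F] AlgebraicClosure L')
      (Affine.Point.map (W' := P.W) (ι : AlgebraicClosure L' →ₐ[P.F] AlgebraicClosure P.F) Q) = Q
    rw [Affine.Point.map_map, hcomp]
    cases Q <;> rfl
  have hΦΨ : ∀ Q, Φ (Ψ Q) = Q := by
    intro Q
    have hcomp : (ι : AlgebraicClosure L' →ₐ[P.F] AlgebraicClosure P.F).comp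
        (ι.symm : AlgebraicClosure P.F →ₐ[P.F] AlgebraicClosure L') = AlgHom.id P.F _ := by
      ext x; exact ι.apply_symm_apply x
    show Affine.Point.map (W' := P.W) (ι : AlgebraicClosure L' →ₐ[P.F] AlgebraicClosure P.F)
      (Affine.Point.map (W' := P.W) (ι.symm : AlgebraicClosure P.F →ₐ[P.F] AlgebraicClosure L') Q) = Q
    rw [Affine.Point.map_map, hcomp]
    cases Q <;> rfl
  -- change of group `Γ_{L'} → Γ_L`, `τ ↦ ι ∘ τ ∘ ι⁻¹`, and equivariance of `Φ`
  set lift : absoluteGaloisGroup L' → absoluteGaloisGroup P.F := fun τ =>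
    (absoluteGaloisGroup.toAlgEquiv P.F).symm
      (ι.symm.trans (((absoluteGaloisGroup.toAlgEquiv L' τ).restrictScalars P.F).trans ι)) with hlift
  have hequiv : ∀ (τ : absoluteGaloisGroup L') (Q : geomPoints (P.W.map (algebraMap P.F L'))),
      Φ (τ • Q) = lift τ • Φ Q := by
    intro τ Q
    set τ' : AlgebraicClosure L' →ₐ[P.F] AlgebraicClosure L' :=
      (((absoluteGaloisGroup.toAlgEquiv L' τ).restrictScalars P.F :
        AlgebraicClosure L' ≃ₐ[P.F] AlgebraicClosure L') :
        AlgebraicClosure L' →ₐ[P.F] AlgebraicClosure L') with hτ'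
    set τ'' : AlgebraicClosure P.F →ₐ[P.F] AlgebraicClosure P.F :=
      ((ι.symm.trans (((absoluteGaloisGroup.toAlgEquiv L' τ).restrictScalars P.F).trans ι) :
        AlgebraicClosure P.F ≃ₐ[P.F] AlgebraicClosure P.F) :
        AlgebraicClosure P.F →ₐ[P.F] AlgebraicClosure P.F) with hτ''
    have h1 : τ • Q = Affine.Point.map (W' := P.W) τ' Q := by
      cases Q <;> rfl
    have h2 : lift τ • Φ Q = Affine.Point.map (W' := P.W) τ'' (Φ Q) := by
      cases (Φ Q) <;> rfl
    have hcomp : (ι : AlgebraicClosure L' →ₐ[P.F] AlgebraicClosure P.F).comp τ' =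
        τ''.comp (ι : AlgebraicClosure L' →ₐ[P.F] AlgebraicClosure P.F) := by
      ext x
      simp [hτ', hτ'', AlgEquiv.symm_apply_apply]
    rw [h1, h2]
    show Affine.Point.map (W' := P.W) (ι : AlgebraicClosure L' →ₐ[P.F] AlgebraicClosure P.F)
        (Affine.Point.map (W' := P.W) τ' Q) =
      Affine.Point.map (W' := P.W) τ''
        (Affine.Point.map (W' := P.W) (ι : AlgebraicClosure L' →ₐ[P.F] AlgebraicClosure P.F) Q)
    rw [Affine.Point.map_map, Affine.Point.map_map, hcomp]
  -- restriction to the `n`-torsion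
  have hΦmem : ∀ Q : (P.W.map (algebraMap P.F L')).geomTorsion (n : ℤ),
      Φ (Q : geomPoints (P.W.map (algebraMap P.F L'))) ∈ P.W.geomTorsion (n : ℤ) := by
    intro Q
    rw [AddSubgroup.torsionBy.nsmul_iff, ← map_nsmul, AddSubgroup.torsionBy.nsmul_iff.mp Q.2, map_zero]
  have hΨmem : ∀ Q : P.W.geomTorsion (n : ℤ),
      Ψ (Q : geomPoints P.W) ∈ (P.W.map (algebraMap P.F L')).geomTorsion (n : ℤ) := by
    intro Q
    rw [AddSubgroup.torsionBy.nsmul_iff, ← map_nsmul, AddSubgroup.torsionBy.nsmul_iff.mp Q.2, map_zero]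
  set ΦT : (P.W.map (algebraMap P.F L')).geomTorsion (n : ℤ) ≃+ P.W.geomTorsion (n : ℤ) :=
    { toFun := fun Q => ⟨Φ Q, hΦmem Q⟩
      invFun := fun Q => ⟨Ψ Q, hΨmem Q⟩
      left_inv := fun Q => Subtype.ext (hΨΦ Q)
      right_inv := fun Q => Subtype.ext (hΦΨ Q)
      map_add' := fun Q Q' => Subtype.ext (by simp) } with hΦT
  have hΦT_coe : ∀ Q, ((ΦT Q : P.W.geomTorsion (n : ℤ)) : geomPoints P.W) = Φ Q := fun Q => rfl
  have hequivT : ∀ (τ : absoluteGaloisGroup L') (Q : (P.W.map (algebraMap P.F L')).geomTorsion (n : ℤ)),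
      ΦT (τ • Q) = lift τ • ΦT Q := by
    intro τ Q
    apply Subtype.ext
    rw [hΦT_coe, AddSubgroup.torsionBy.coe_smul, AddSubgroup.torsionBy.coe_smul, hΦT_coe, hequiv]
  -- the transfer of `SL₂`-containment
  letI instL : Module (ZMod n) (P.W.geomTorsion (n : ℤ)) := AddSubgroup.torsionBy.zmodModule
  letI instL' : Module (ZMod n) ((P.W.map (algebraMap P.F L')).geomTorsion (n : ℤ)) :=
    AddSubgroup.torsionBy.zmodModule
  set Λ : (P.W.map (algebraMap P.F L')).geomTorsion (n : ℤ) ≃ₗ[ZMod n] P.W.geomTorsion (n : ℤ) :=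
    { ΦT.toAddMonoidHom.toZModLinearMap n with
      invFun := ΦT.symm
      left_inv := fun x => ΦT.symm_apply_apply x
      right_inv := fun x => ΦT.apply_symm_apply x } with hΛ
  have hΛ_apply : ∀ x, Λ x = ΦT x := fun x => rfl
  have hΛ_symm : ∀ x, Λ.symm x = ΦT.symm x := fun x => rfl
  intro f hf
  -- `f' = Λ⁻¹ f Λ`, a determinant-one endomorphism of `E_{L'}[n]`
  set f' : (P.W.map (algebraMap P.F L')).geomTorsion (n : ℤ) →ₗ[ZMod n]
      (P.W.map (algebraMap P.F L')).geomTorsion (n : ℤ) :=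
    (Λ.symm : _ →ₗ[ZMod n] _) ∘ₗ f ∘ₗ (Λ : _ →ₗ[ZMod n] _) with hf'
  have hf'det : LinearMap.det f' = 1 := by
    have hc := LinearMap.det_conj f Λ.symm
    simp only [LinearEquiv.symm_symm] at hc
    rw [hf', hc]
    exact hf
  obtain ⟨τ, hτ⟩ := h f' hf'det
  refine ⟨lift τ, fun x => ?_⟩
  have hx : x = ΦT (ΦT.symm x) := (ΦT.apply_symm_apply x).symm
  rw [hx, ← hequivT, hτ, hf']
  simp only [LinearMap.coe_comp, LinearEquiv.coe_coe, Function.comp_apply, hΛ_apply, hΛ_symm,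
    ΦT.apply_symm_apply]

end EllPoint

end Literature.NumberTheory.DiophantineGeometry.GenEll
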